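import Summits.AtomisticToContinuum.Crystallization.Theorems.FrustratedLawDichotomyStrainedPatchRecutPairs

/-!
# Recut kinematics: the inverse of `1 + A`, the conjugate polynomial bend, the recut lattice, window separation (lens-5 g54, file L)

Crux 27623 (T-side), node [CORE-FAR], leaf (RFᴿ-bent₁) = `…RecutPairs.RecutBent1` — the TABLE-FREE kinematic lemmas of its instance half (NODE-g54 §5
(R2)–(R4)), proved once over general constants:
* §1 `antilipschitz_one_add`: `‖A‖ ≤ α ⇒ (1 − α)‖u‖ ≤ ‖(1+A)u‖`; `exists_inverse_one_add`: for `α < 1` a two-sided inverse `B` of `1 + A` with `‖B‖ ≤ (1−α)⁻¹`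
  (finite dimension: injective ⇒ bijective; the bound from the anti-Lipschitz estimate — no Neumann series);
* §2 ★ `exists_conj_polyBend`: `b₀ ∈ polyBends q₂ q₃`, `‖A‖ ≤ α < 1` ⇒ the CONJUGATE bend `b₁ = (1+A)∘b₀∘(1+A)⁻¹` is a polynomial bend with
  `b₁ ∈ polyBends (q₂(1+α)/(1−α)²) (q₃(1+α)/(1−α)³)` and `b₁ ((1+A) v) = (1+A) (b₀ v)`; ★ `exists_conj_bends1`: at the record pins (`bends0`, `α = κL₀·T ≤ 1/150`)
  the conjugate lies in `bends1` (factors `1.0203`, `1.0272 ≤ 11/10`);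
* §3 `latPt_mul`, ★ `latSet_mul`: the lattice vector set of the recut matrix `(1+A)·G` is the `(1+A)`-image of the chart's; `homRange` of the recut likewise;
* §4 ★ `windowSep_recut`: window separation `s` of the chart's bent lattice ⇒ separation `(1−α)s` of the `(1+A)`-images; `norm_le_window`: a recut site of norm
  `≤ 133/10` comes from a chart lattice vector of bent norm `≤ 27/2` when `α ≤ 1/150` — so `InteriorChart`'s `WindowSep … (27/2) (3/4)` yields `Sep (7/10)` of the
  re-cut image including the ENTERING sites (`(1 − 1/150)·3/4 ≥ 7/10`, `sep_recut_ge`).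
No sorry, no new axioms, no cite tokens, no instances / notation.
-/

namespace Summit.AtomisticToContinuum.Crystallization.Theorems.FrustratedLawDichotomyStrainedPatchRecutKinematics

open scoped BigOperators Classical
open Summit.AtomisticToContinuum.Crystallization.Theorems.FrustratedLawDichotomyAveragingCut
open Summit.AtomisticToContinuum.Crystallization.Theorems.FrustratedLawDichotomyStrainedPatchHomSplit
open Summit.AtomisticToContinuum.Crystallization.Theorems.FrustratedLawDichotomyStrainedPatchChartFamiliesBent
open Summit.AtomisticToContinuum.Crystallization.Theorems.FrustratedLawDichotomyStrainedPatchChartFamiliesPinned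
open Summit.AtomisticToContinuum.Crystallization.Theorems.FrustratedLawDichotomyStrainedPatchEnvelopeLaw
open Summit.AtomisticToContinuum.Crystallization.Theorems.FrustratedLawDichotomyStrainedPatchRecutPairs
open Literature.Barriers.AtomisticToContinuum.FlatleyTheil2015 (fccVec)

/-! ## §1. The inverse of `1 + A` -/

/-- `‖1 + A‖ ≤ 1 + α`. [formal bookkeeping] -/
theorem norm_one_add_le (A : E3 →L[ℝ] E3) {α : ℝ} (hA : ‖A‖ ≤ α) : ‖(1 : E3 →L[ℝ] E3) + A‖ ≤ 1 + α :=
  (norm_add_le _ _).trans (add_le_add (by rw [ContinuousLinearMap.one_def]; exact ContinuousLinearMap.norm_id_le) hA)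

/-- The anti-Lipschitz estimate: `(1 − α)‖u‖ ≤ ‖(1+A)u‖` for `‖A‖ ≤ α`. [folklore] -/
theorem antilipschitz_one_add (A : E3 →L[ℝ] E3) {α : ℝ} (hA : ‖A‖ ≤ α) (u : E3) : (1 - α) * ‖u‖ ≤ ‖((1 : E3 →L[ℝ] E3) + A) u‖ := by
  have h1 : ‖A u‖ ≤ α * ‖u‖ := (A.le_opNorm u).trans (mul_le_mul_of_nonneg_right hA (norm_nonneg _))
  have h2 : ‖u‖ - ‖A u‖ ≤ ‖u + A u‖ := by
    have h := norm_sub_norm_le u (-(A u))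
    rwa [norm_neg, sub_neg_eq_add] at h
  calc (1 - α) * ‖u‖ = ‖u‖ - α * ‖u‖ := by ring
    _ ≤ ‖u‖ - ‖A u‖ := by linarith
    _ ≤ ‖u + A u‖ := h2
    _ = ‖((1 : E3 →L[ℝ] E3) + A) u‖ := by simp only [add_apply, one_apply_eq_self]

/-- ★ For `‖A‖ ≤ α < 1`, `1 + A` has a two-sided inverse `B` with `‖B‖ ≤ (1 − α)⁻¹`. [folklore] -/
theorem exists_inverse_one_add (A : E3 →L[ℝ] E3) {α : ℝ} (hA : ‖A‖ ≤ α) (hα : α < 1) :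
    ∃ B : E3 →L[ℝ] E3, (∀ u, B (((1 : E3 →L[ℝ] E3) + A) u) = u) ∧ (∀ w, ((1 : E3 →L[ℝ] E3) + A) (B w) = w) ∧ ‖B‖ ≤ (1 - α)⁻¹ := by
  have hpos : 0 < 1 - α := by linarith
  have hinj : Function.Injective (((1 : E3 →L[ℝ] E3) + A : E3 →L[ℝ] E3) : E3 →ₗ[ℝ] E3) := by
    intro u v huv
    have h := antilipschitz_one_add A hA (u - v)
    have huv' : ((1 : E3 →L[ℝ] E3) + A) (u - v) = 0 := by
      rw [map_sub, sub_eq_zero]; exact huv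
    rw [huv', norm_zero] at h
    have hn : ‖u - v‖ ≤ 0 := by nlinarith [norm_nonneg (u - v)]
    exact sub_eq_zero.1 (norm_le_zero_iff.1 hn)
  have hsurj : Function.Surjective (((1 : E3 →L[ℝ] E3) + A : E3 →L[ℝ] E3) : E3 →ₗ[ℝ] E3) :=
    LinearMap.injective_iff_surjective.1 hinj
  let e : E3 ≃ₗ[ℝ] E3 := LinearEquiv.ofBijective _ ⟨hinj, hsurj⟩
  have he : ∀ u, e u = ((1 : E3 →L[ℝ] E3) + A) u := fun u => rfl
  let B : E3 →L[ℝ] E3 := LinearMap.toContinuousLinearMap (e.symm : E3 →ₗ[ℝ] E3)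
  have hB : ∀ w, B w = e.symm w := fun w => rfl
  have hBT : ∀ u, B (((1 : E3 →L[ℝ] E3) + A) u) = u := fun u => by rw [hB, ← he, e.symm_apply_apply]
  have hTB : ∀ w, ((1 : E3 →L[ℝ] E3) + A) (B w) = w := fun w => by rw [hB, ← he, e.apply_symm_apply]
  refine ⟨B, hBT, hTB, ContinuousLinearMap.opNorm_le_bound _ (inv_nonneg.2 hpos.le) fun w => ?_⟩
  have h := antilipschitz_one_add A hA (B w)
  rw [hTB] at h
  calc ‖B w‖ = (1 - α)⁻¹ * ((1 - α) * ‖B w‖) := by field_simp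
    _ ≤ (1 - α)⁻¹ * ‖w‖ := mul_le_mul_of_nonneg_left h (inv_nonneg.2 hpos.le)

/-! ## §2. The conjugate polynomial bend -/

/-- ★ **The conjugate bend.**  For `b₀ ∈ polyBends q₂ q₃` (`b₀ v = v + Q v v + C v v v`) and `‖A‖ ≤ α < 1` there is a polynomial bend `b₁` with
`b₁ ((1+A) v) = (1+A) (b₀ v)` for all `v` (namely `u ↦ u + (1+A)Q(Bu,Bu) + (1+A)C(Bu,Bu,Bu)`, `B = (1+A)⁻¹`), and
`b₁ ∈ polyBends (q₂(1+α)/(1−α)²) (q₃(1+α)/(1−α)³)`. [folklore] -/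
theorem exists_conj_polyBend {q₂ q₃ α : ℝ} (hq₂ : 0 ≤ q₂) (hq₃ : 0 ≤ q₃) (hα : α < 1) {b₀ : E3 → E3} (hb : b₀ ∈ polyBends q₂ q₃)
    (A : E3 →L[ℝ] E3) (hA : ‖A‖ ≤ α) :
    ∃ b₁ ∈ polyBends (q₂ * (1 + α) / (1 - α) ^ 2) (q₃ * (1 + α) / (1 - α) ^ 3), ∀ v, b₁ (((1 : E3 →L[ℝ] E3) + A) v) = ((1 : E3 →L[ℝ] E3) + A) (b₀ v) := by
  obtain ⟨Q, C, hQ, hC, hb⟩ := hb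
  obtain ⟨B, hBT, hTB, hBn⟩ := exists_inverse_one_add A hA hα
  have hpos : 0 < 1 - α := by linarith
  have hα0 : 0 ≤ α := (norm_nonneg _).trans hA
  set T : E3 →L[ℝ] E3 := (1 : E3 →L[ℝ] E3) + A with hTdef
  have hTn : ‖T‖ ≤ 1 + α := norm_one_add_le A hA
  -- the conjugated multilinear data
  let Q₁ : E3 →ₗ[ℝ] E3 →ₗ[ℝ] E3 := (Q.compl₁₂ (B : E3 →ₗ[ℝ] E3) (B : E3 →ₗ[ℝ] E3)).compr₂ (T : E3 →ₗ[ℝ] E3)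
  let L : (E3 →ₗ[ℝ] E3) →ₗ[ℝ] (E3 →ₗ[ℝ] E3) := (LinearMap.llcomp ℝ E3 E3 E3 (T : E3 →ₗ[ℝ] E3)).comp (LinearMap.lcomp ℝ E3 (B : E3 →ₗ[ℝ] E3))
  let C₁ : E3 →ₗ[ℝ] E3 →ₗ[ℝ] E3 →ₗ[ℝ] E3 := (C.compl₁₂ (B : E3 →ₗ[ℝ] E3) (B : E3 →ₗ[ℝ] E3)).compr₂ L
  have hQ₁ : ∀ u v, Q₁ u v = T (Q (B u) (B v)) := fun u v => by
    simp only [Q₁, LinearMap.compr₂_apply, LinearMap.compl₁₂_apply, ContinuousLinearMap.coe_coe]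
  have hC₁ : ∀ u v w, C₁ u v w = T (C (B u) (B v) (B w)) := fun u v w => by
    simp only [C₁, L, LinearMap.compr₂_apply, LinearMap.compl₁₂_apply, LinearMap.comp_apply, LinearMap.llcomp_apply, LinearMap.lcomp_apply,
      ContinuousLinearMap.coe_coe]
  have hBle : ∀ u, ‖B u‖ ≤ (1 - α)⁻¹ * ‖u‖ := fun u => (B.le_opNorm u).trans (mul_le_mul_of_nonneg_right hBn (norm_nonneg _))
  have hTle : ∀ x, ‖T x‖ ≤ (1 + α) * ‖x‖ := fun x => (T.le_opNorm x).trans (mul_le_mul_of_nonneg_right hTn (norm_nonneg _))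
  refine ⟨fun u => u + Q₁ u u + C₁ u u u, ⟨Q₁, C₁, ?_, ?_, fun u => rfl⟩, ?_⟩
  · intro u v
    rw [hQ₁]
    have h1 := hTle (Q (B u) (B v))
    have h2 : ‖Q (B u) (B v)‖ ≤ q₂ * ((1 - α)⁻¹ * ‖u‖) * ((1 - α)⁻¹ * ‖v‖) :=
      (hQ (B u) (B v)).trans (mul_le_mul (mul_le_mul_of_nonneg_left (hBle u) hq₂) (hBle v) (norm_nonneg _)
        (mul_nonneg hq₂ (mul_nonneg (inv_nonneg.2 hpos.le) (norm_nonneg _))))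
    calc ‖T (Q (B u) (B v))‖ ≤ (1 + α) * ‖Q (B u) (B v)‖ := h1
      _ ≤ (1 + α) * (q₂ * ((1 - α)⁻¹ * ‖u‖) * ((1 - α)⁻¹ * ‖v‖)) := mul_le_mul_of_nonneg_left h2 (by linarith)
      _ = q₂ * (1 + α) / (1 - α) ^ 2 * ‖u‖ * ‖v‖ := by field_simp
  · intro u v w
    rw [hC₁]
    have h1 := hTle (C (B u) (B v) (B w))
    have h2 : ‖C (B u) (B v) (B w)‖ ≤ q₃ * ((1 - α)⁻¹ * ‖u‖) * ((1 - α)⁻¹ * ‖v‖) * ((1 - α)⁻¹ * ‖w‖) :=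
      (hC (B u) (B v) (B w)).trans (mul_le_mul (mul_le_mul (mul_le_mul_of_nonneg_left (hBle u) hq₃) (hBle v) (norm_nonneg _)
        (mul_nonneg hq₃ (mul_nonneg (inv_nonneg.2 hpos.le) (norm_nonneg _)))) (hBle w) (norm_nonneg _)
        (mul_nonneg (mul_nonneg hq₃ (mul_nonneg (inv_nonneg.2 hpos.le) (norm_nonneg _))) (mul_nonneg (inv_nonneg.2 hpos.le) (norm_nonneg _))))
    calc ‖T (C (B u) (B v) (B w))‖ ≤ (1 + α) * ‖C (B u) (B v) (B w)‖ := h1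
      _ ≤ (1 + α) * (q₃ * ((1 - α)⁻¹ * ‖u‖) * ((1 - α)⁻¹ * ‖v‖) * ((1 - α)⁻¹ * ‖w‖)) := mul_le_mul_of_nonneg_left h2 (by linarith)
      _ = q₃ * (1 + α) / (1 - α) ^ 3 * ‖u‖ * ‖v‖ * ‖w‖ := by field_simp
  · intro v
    show T v + Q₁ (T v) (T v) + C₁ (T v) (T v) (T v) = T (b₀ v)
    rw [hQ₁, hC₁, hBT, hb v, map_add, map_add]

/-- Numerics of the record pins: `α = 1/150` inflates `(q₂, q₃) = (1/200, 1/2000)` to at most `(11/2000, 11/20000)`. [formal bookkeeping] -/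
theorem conj_factors_le : (1 / 200 : ℝ) * (1 + 1 / 150) / (1 - 1 / 150) ^ 2 ≤ 11 / 2000 ∧ (1 / 2000 : ℝ) * (1 + 1 / 150) / (1 - 1 / 150) ^ 3 ≤ 11 / 20000 := by
  constructor <;> norm_num

/-- ★ **The conjugate of a `bends0` bend by `1 + A`, `‖A‖ ≤ 1/150`, lies in `bends1`.**  (At the record pins `‖A‖ ≤ κL₀·t ≤ (2/5)·(1/60) = 1/150`.) [folklore] -/
theorem exists_conj_bends1 {b₀ : E3 → E3} (hb : b₀ ∈ bends0) (A : E3 →L[ℝ] E3) (hA : ‖A‖ ≤ 1 / 150) :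
    ∃ b₁ ∈ bends1, ∀ v, b₁ (((1 : E3 →L[ℝ] E3) + A) v) = ((1 : E3 →L[ℝ] E3) + A) (b₀ v) := by
  obtain ⟨b₁, hb₁, h⟩ := exists_conj_polyBend (q₂ := 1 / 200) (q₃ := 1 / 2000) (by norm_num) (by norm_num) (by norm_num : (1 / 150 : ℝ) < 1)
    (by simpa [bends0] using hb) A hA
  exact ⟨b₁, by simpa [bends1] using polyBends_mono conj_factors_le.1 conj_factors_le.2 hb₁, h⟩

/-- `κL₀·t ≤ 1/150` on the law's range `0 ≤ t ≤ 1/60`. [formal bookkeeping] -/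
theorem kL0_mul_le {t : ℝ} (ht : 0 ≤ t) (ht' : t ≤ 1 / 60) : kL0 * max t 0 ≤ 1 / 150 := by
  rw [max_eq_left ht, kL0]; linarith

/-! ## §3. The recut lattice: vector sets and homogeneous balls of the matrix `(1+A)·G` -/

/-- `(T·G) x = T (G x)` (multiplication of endomorphisms is composition). [formal bookkeeping] -/
theorem mul_apply_vec (T G : E3 →L[ℝ] E3) (x : E3) : (T * G) x = T (G x) := rfl

/-- `latPt (T·G) f a = T (latPt G f a)`. [formal bookkeeping] -/
theorem latPt_mul (T G : E3 →L[ℝ] E3) (f : Fin 3 → E3) (a : Fin 3 → ℤ) : latPt (T * G) f a = T (latPt G f a) := rfl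

/-- ★ The lattice vector set of the recut matrix is the `T`-image of the chart's: `latSet φ (T·G) ξ = T '' latSet φ G ξ`. [formal bookkeeping] -/
theorem latSet_mul (φ : Bool) (T G : E3 →L[ℝ] E3) (ξ : E3) : latSet φ (T * G) ξ = ⇑T '' latSet φ G ξ := by
  ext v
  cases φ <;> simp only [latSet, cond_true, cond_false, Set.mem_setOf_eq, Set.mem_image, latPt_mul, mul_apply_vec]
  · constructor
    · rintro ⟨a, h | h⟩
      · exact ⟨_, ⟨a, Or.inl rfl⟩, h.symm⟩
      · exact ⟨_, ⟨a, Or.inr rfl⟩, by rw [map_add]; exact h.symm⟩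
    · rintro ⟨w, ⟨a, hw | hw⟩, rfl⟩
      · exact ⟨a, Or.inl (by rw [hw])⟩
      · exact ⟨a, Or.inr (by rw [hw, map_add])⟩
  · constructor
    · rintro ⟨a, h⟩
      exact ⟨_, ⟨a, rfl⟩, h.symm⟩
    · rintro ⟨w, ⟨a, hw⟩, rfl⟩
      exact ⟨a, by rw [hw]⟩

/-- The homogeneous ball of the recut matrix about `x₁`: the points within `R` of `x₁` whose offset is a `T`-image of a chart lattice vector. [formal bookkeeping] -/
theorem mem_homRange_mul_iff {φ : Bool} {T G : E3 →L[ℝ] E3} {ξ : E3} {R : ℝ} {x₁ x : E3} :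
    x ∈ homRange φ (T * G) ξ R x₁ ↔ dist x x₁ ≤ R ∧ ∃ v ∈ latSet φ G ξ, x - x₁ = T v := by
  rw [mem_homRange_iff, latSet_mul, Set.mem_image]
  simp only [eq_comm]

/-! ## §4. Window separation survives the recut -/

/-- ★ Window separation `s` of the chart's bent lattice ⇒ the `(1+A)`-images of two distinct window vectors are `(1 − α)s` apart. [folklore] -/
theorem windowSep_recut {φ : Bool} {b : E3 → E3} {G : E3 →L[ℝ] E3} {ξ : E3} {R s α : ℝ} (hW : WindowSep φ b G ξ R s) (A : E3 →L[ℝ] E3) (hA : ‖A‖ ≤ α)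
    (hα : α ≤ 1) {v v' : E3} (hv : v ∈ latSet φ G ξ) (hv' : v' ∈ latSet φ G ξ) (hne : v ≠ v') (hR : ‖b v‖ ≤ R) (hR' : ‖b v'‖ ≤ R) :
    (1 - α) * s ≤ dist (((1 : E3 →L[ℝ] E3) + A) (b v)) (((1 : E3 →L[ℝ] E3) + A) (b v')) := by
  have hs := hW v hv v' hv' hne hR hR'
  have h := antilipschitz_one_add A hA (b v - b v')
  rw [dist_eq_norm, ← map_sub]
  rw [dist_eq_norm] at hs
  calc (1 - α) * s ≤ (1 - α) * ‖b v - b v'‖ := mul_le_mul_of_nonneg_left hs (by linarith)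
    _ ≤ _ := h

/-- A recut site of norm `≤ 133/10` comes from a chart vector of bent norm `≤ 27/2` (`α ≤ 1/150`: `133/10 ≤ (1 − 1/150)·27/2`). [formal bookkeeping] -/
theorem norm_le_window (A : E3 →L[ℝ] E3) (hA : ‖A‖ ≤ 1 / 150) {x : E3} (hx : ‖((1 : E3 →L[ℝ] E3) + A) x‖ ≤ 133 / 10) : ‖x‖ ≤ 27 / 2 := by
  have h := antilipschitz_one_add A hA x
  nlinarith [norm_nonneg x]

/-- ★ At the record pins: `WindowSep … (27/2) (3/4)` of the chart ⇒ any two distinct recut sites of norm `≤ 133/10` are `≥ 7/10` apart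
(`(1 − 1/150)·3/4 = 0.745`). [folklore] -/
theorem sep_recut_ge {φ : Bool} {b : E3 → E3} {G : E3 →L[ℝ] E3} {ξ : E3} (hW : WindowSep φ b G ξ (27 / 2) (3 / 4)) (A : E3 →L[ℝ] E3)
    (hA : ‖A‖ ≤ 1 / 150) {v v' : E3} (hv : v ∈ latSet φ G ξ) (hv' : v' ∈ latSet φ G ξ) (hne : v ≠ v')
    (hR : ‖((1 : E3 →L[ℝ] E3) + A) (b v)‖ ≤ 133 / 10) (hR' : ‖((1 : E3 →L[ℝ] E3) + A) (b v')‖ ≤ 133 / 10) :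
    7 / 10 ≤ dist (((1 : E3 →L[ℝ] E3) + A) (b v)) (((1 : E3 →L[ℝ] E3) + A) (b v')) := by
  have h := windowSep_recut hW A hA (by norm_num) hv hv' hne (norm_le_window A hA hR) (norm_le_window A hA hR')
  linarith

end Summit.AtomisticToContinuum.Crystallization.Theorems.FrustratedLawDichotomyStrainedPatchRecutKinematics
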